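import Summits.ValiantsHypothesis.ValiantsHypothesis.Theorems.LacunarySymmetroidMatrixDescartesCensusM4K7CH60C1
import Summits.ValiantsHypothesis.ValiantsHypothesis.Theorems.LacunarySymmetroidMatrixDescartesCensusM4K7CH60C2

/-!
# `MatrixDescartes` census certificate `M4K7CH60` (by reflection, 2 chunks): format `(m, K) = (4, 7)`, `60 ≤ Z₊` — hence `ζ_sym(4,7) ≥ 60`

HONEST FRAMING.  Generated by `reflect_row.py --chunks 2` (val-V1-extremal engine seat val-v1x-eng-10) from ONE census witness
record; it certifies in the kernel only `¬ PosRootLawAt 4 7 59` (≥ 60 distinct positive determinant roots of the explicit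
integer symmetric pencil written in the chunk files `…LacunarySymmetroidMatrixDescartesCensusM4K7CH60C1 … C2`).  Each chunk file proves, by ONE kernel computation
(`decide +kernel`, kit `…CensusReflectChunks :: chunkCheck`), that its share of the 61 rational test points is positive, strictly
increasing and carries strictly alternating exact determinant signs; consecutive chunks share their junction point; this file
glues the localised root counts (`le_card_Ioo_of_chunkCheck`, `card_filter_Ioo_add_le`) and checks symmetry (`symmB`).
Nothing is claimed about the asymptotic crux `Theses.LacunarySymmetroid.MatrixDescartes` (stmt-ValiantsHypothesis-18050)
nor about `VP ≠ VNP`.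

Source record: `E10G0-CHAIN60s-4-7` (val-v1x-eng-10 chain.py junction of val-v1x-eng-1 E1V1X-CAPF30 (4,4)=30 with itself); exponents `d = (0, 3, 4, 623, 626, 627, 1246)`; integer entries up to
4248 digits; data sha256/16 `641165dff9ad358d`; 61 points, exact `det` signs `-+-+-+-+-+-+-+-+-+-+-+-+-+-+-+-+-+-+-+-+-+-+-+-+-+-+-+-+-+-+-`; chunks: 30 roots, 30 roots.
Context: `D(4,7) = 209`, `P(4,7) = 54`.  Generated 2026-08-28T18:18Z.
[folklore] Descartes / intermediate value theorem; certificate by kernel reflection.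
-/

-- `Summit.ValiantsHypothesis.ValiantsHypothesis.…` repeats a component by the D-0017 layout
-- (single-conjunct summit), which the `dupNamespace` linter flags; the name is mandated.
set_option linter.dupNamespace false

namespace Summit.ValiantsHypothesis.ValiantsHypothesis.Theorems.LacunarySymmetroidMatrixDescartes.Census.Reflect

open Summit.ValiantsHypothesis.ValiantsHypothesis.Theorems.MatrixDescartes.Negative (PosRootLawAt)

set_option maxHeartbeats 4000000 in
set_option maxRecDepth 16384 in
/-- **`ζ_sym(4,7) ≥ 60`** (record `E10G0-CHAIN60s-4-7`), assembled from 2 kernel-checked chunks. [folklore] -/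
theorem chain60_not_posRootLawAt_4_7_59 : ¬ PosRootLawAt 4 7 59 := by
  have h1 := le_card_Ioo_of_chunkCheck chain60_not_posRootLawAt_4_7_59_c1
  have l1 := ptR_lt_of_chunkCheck chain60_not_posRootLawAt_4_7_59_c1
  have h2 := le_card_Ioo_of_chunkCheck chain60_not_posRootLawAt_4_7_59_c2
  have l2 := ptR_lt_of_chunkCheck chain60_not_posRootLawAt_4_7_59_c2
  have g2 := (Nat.add_le_add h1 h2).trans (card_filter_Ioo_add_le _ l1.le l2.le)
  exact not_posRootLawAt_of_le_card_Ioo (by decide +kernel) (ptR_pos_of_chunkCheck chain60_not_posRootLawAt_4_7_59_c1).le g2 (by norm_num)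

end Summit.ValiantsHypothesis.ValiantsHypothesis.Theorems.LacunarySymmetroidMatrixDescartes.Census.Reflect
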